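import Literature.IUT.HodgeArakelov.GaloisPairRigidityForgetSurjective
import Literature.IUT.HodgeArakelov.AbsTopMonoidsGenuineProducer
import Literature.AnabelianGeometry.AbsoluteAnabelian.AbsTopIII.EquivariantSignRigidity
import Literature.AnabelianGeometry.AbsoluteAnabelian.MLFClosureUnitsAnchorProofs
import HarnessLib

/-!
# [IUTchII] Remark 1.11.1 (i) (c) in the `(∗ĝp) := (∗gp)` reading, AT THE GENUINE PRODUCER: the kernel of
# `Aut(G ↷ O^gp(G)) → Aut(G)` is EXACTLY `{1, x ↦ x⁻¹}` — not a `Ẑ^×` (PROOF-ONLY companion; a faithfulness datum)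

Mochizuki, *Inter-universal Teichmüller theory II*, §1, Remark 1.11.1 (i), kurims manuscript (Dec. 2020) p. 50
[claim: Mochizuki2012, status: disputed] (IUTchII §1 Rmk 1.11.1 (i), kurims p.50): "(b) … `G ↷ O^×(G)` maps surjectively
… onto `Aut(G)`, with kernel given by the … automorphisms … determined by the natural action of `Ẑ^×` [cf. [AbsTopIII],
Proposition 3.3, (ii)]; (c) … `G ↷ O^ĝp(G)` … by the same proof involving the Kummer map".

PROOF-ONLY companion (no `def`, no `instance`, no `structure`; abc-iut cell, block C / wave W6, seat abc-iut-w6-d016,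
sequel «RMK1111C-GP-KERNEL» of this seat's `AbsTopMonoidsGroupificationProofs.lean` p428334 and
`GaloisPairRigidityForgetSurjective.lean` p429697) about the READING `(∗ĝp) := (∗gp)` of abc-iut-w5-d193's
`ProfiniteGroupificationsGrothendieck.lean` (p425301: `O^ĝp(G) :=` the Grothendieck group `O^gp(G) = AbsTopMonoids.Ogp G`,
profinite completion NOT modelled) at abc-iut-L6-t13's GENUINE producer `AbsTopMonoids.genuineOfModel S C ε hΔ hq`
(`O^⊳(G) = 𝒪_k̄^⊳`, `G` acting through `theta : G ⥲ Gal(k̄/k)`).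

What the kernel says:

* `PairAut.inv_mem_over_one` — over EVERY inhabitant and every action by automorphisms of a commutative group, the
  inversion `x ↦ x⁻¹` is a pair automorphism over `1 ∈ Aut(G)`;
* `AbsTopMonoids.genuineOfModel_exists_ogpEquiv` — at the genuine producer `O^gp(G) = (𝒪_k̄^⊳)^gp` IS `k̄^×`: a
  multiplicative isomorphism `Φ : O^gp(G) ⥲ k̄^×` with `Φ([m]) = m` (every `x ∈ k̄^×` has `x` or `x⁻¹` in `𝒪_k̄^⊳`,
  abc-iut's `MLFClosure.mem_nonzeroIntegers_or_inv_mem`; Mathlib `Localization.mulEquivOfQuotient`), unique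
  (`…_ogpEquiv_unique`), and `G`-EQUIVARIANT for the action induced on the groupification (`…_ogpEquiv_equivariant`);
* `units_equivariant_eq_id_or_inv` — [AbsTopIII] Prop. 3.3 (ii), `TLG` case, in `k̄^×`-form: a
  `Gal(k̄/k)`-equivariant automorphism of `k̄^×` is the identity or the inversion (transport of abc-iut-L6's
  `MLFClosure.nonZeroDivisors_equivariant_eq_id_or_inv`, `EquivariantSignRigidity.lean`);
* **`AbsTopMonoids.genuineOfModel_pairAut_ogp_over_one`** / **`…_forget_ogp_eq_one_iff`** — hence at the genuine
  producer, for the induced action `G ↷ O^gp(G)`, a pair automorphism over `1 ∈ Aut(G)` is `1` or `(1, x ↦ x⁻¹)`, and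
  these two are distinct (`…_inv_ne_refl`, `2² ≠ 1` in `k̄`): **the kernel of `Aut(G ↷ O^gp(G)) → Aut(G)` has exactly two
  elements**;
* `AbsTopMonoids.genuineOfModel_zhat_through_ogp` — consequently ANY `Ẑ^×`-"action" `z : Ẑ^× → Aut(O^gp(G))` by
  `G`-equivariant automorphisms (the shape of the `zhatPow` datum of `Rmk1111_c`) takes only the values `1`, `x ↦ x⁻¹`.

READING / HONEST LABEL. This is a FAITHFULNESS DATUM, not a refutation of anything printed: print's (c) concerns the
ind-topological module `O^ĝp(G)` = inductive limit of PROFINITE COMPLETIONS (on which `Ẑ^×` acts faithfully), whereas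
in the `(∗ĝp) := (∗gp)` reading the carrier is `k̄^×`, whose `G`-equivariant automorphism group is `{±1}` ([AbsTopIII]
Prop. 3.3 (i)/(ii), `TLG`). So the `Γ = Ẑ^×`-indeterminacy of Cor. 1.11 / Rmk. 1.11.1 (ii) CANNOT be realised on
`O^gp(G)`: the genuine `(∗ĝp)` (L6 MERGE-MAP row B9, TODO-merge abc-iut-L4-t3) is needed for (c) as printed. Nothing here
bears on [IUTchIII] Cor. 3.12; no side is taken; typed ≠ proved.
-/

namespace Literature.IUT.HodgeArakelov

open CategoryTheory
open Literature.AnabelianGeometry.AbsoluteAnabelian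
open Algebra.GrothendieckGroup (of)
open scoped nonZeroDivisors

universe u

/-! ## Over every inhabitant: the inversion is a pair automorphism over `1` -/

section Interface

variable {S : ThetaSetting.{u}}

/-- For any action of `G` by automorphisms of a commutative group `M` (e.g. `O^×(G)`, `O^gp(G)`, `O^ĝp(G)`), the
inversion `x ↦ x⁻¹` is an automorphism of the pair `G ↷ M` over `1 ∈ Aut(G)` (the `−1 ∈ Ẑ^×` of print's kernel).
[claim: Mochizuki2012, status: disputed] (IUTchII §1 Rmk 1.11.1 (i), kurims p.50) -/
theorem PairAut.inv_mem_over_one {G : IsoClass S.Gk} {M : Type u} [CommGroup M] (act : G.G →* MulAut M) :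
    ((1 : Aut G), MulEquiv.inv M) ∈ PairAut G M act :=
  (PairAut.mem_over_one_iff act _).mpr fun g m => by
    rw [MulEquiv.inv_apply, MulEquiv.inv_apply, map_inv]

end Interface

/-! ## `k̄^×`-form of [AbsTopIII] Prop. 3.3 (ii), `TLG` -/

section SignRigidity

variable (C : MLFClosure.{0})

/-- **[AbsTopIII] Prop. 3.3 (ii), `TLG`, units form**: a `Gal(k̄/k)`-equivariant multiplicative automorphism `γ` of
`k̄^×` is the identity or the inversion — transport of abc-iut-L6's `MLFClosure.nonZeroDivisors_equivariant_eq_id_or_inv`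
along Mathlib's `nonZeroDivisorsEquivUnits : (k̄)⁰ ≃* k̄^×`. [cite: MochizukiAbsTopIII2015, Proposition 3.3 (ii) p.74] -/
theorem units_equivariant_eq_id_or_inv (γ : (C.K)ˣ ≃* (C.K)ˣ)
    (hγ : ∀ (σ : C.K ≃ₐ[C.k] C.K) (u v : (C.K)ˣ), (v : C.K) = σ (u : C.K) → (γ v : C.K) = σ (γ u : C.K)) :
    (∀ u : (C.K)ˣ, γ u = u) ∨ (∀ u : (C.K)ˣ, γ u = u⁻¹) := by
  let e : (C.K)⁰ ≃* (C.K)ˣ := nonZeroDivisorsEquivUnits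
  have he : ∀ x : (C.K)⁰, ((e x : (C.K)ˣ) : C.K) = x := fun x => rfl
  have hes : ∀ u : (C.K)ˣ, ((e.symm u : (C.K)⁰) : C.K) = u := fun u => rfl
  have hβ : ∀ x : (C.K)⁰, (((e.trans (γ.trans e.symm)) x : (C.K)⁰) : C.K) = (γ (e x) : C.K) := fun x => rfl
  have hβσ : ∀ (σ : C.K ≃ₐ[C.k] C.K) (x y : (C.K)⁰), (y : C.K) = σ x →
      (((e.trans (γ.trans e.symm)) y : (C.K)⁰) : C.K) = σ (((e.trans (γ.trans e.symm)) x : (C.K)⁰) : C.K) := by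
    intro σ x y hxy
    rw [hβ, hβ]
    exact hγ σ (e x) (e y) (by rw [he, he]; exact hxy)
  rcases C.nonZeroDivisors_equivariant_eq_id_or_inv (e.trans (γ.trans e.symm)) hβσ with h | h
  · left
    intro u
    have h1 : (((e.trans (γ.trans e.symm)) (e.symm u) : (C.K)⁰) : C.K) = (e.symm u : C.K) :=
      congrArg Subtype.val (h (e.symm u))
    rw [hβ, MulEquiv.apply_symm_apply, hes] at h1
    exact Units.ext h1
  · right
    intro u
    have h1 := h (e.symm u)
    rw [hβ, MulEquiv.apply_symm_apply, hes] at h1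
    exact Units.ext (by rw [h1, Units.val_inv_eq_inv_val])

end SignRigidity

/-! ## At the genuine producer `AbsTopMonoids.genuineOfModel` -/

section Genuine

variable (S : ThetaSetting.{0}) (C : MLFClosure.{0})
  (ε : S.Gk ≃ₜ* (ModelMLFGaloisData.galois C.k C.K).tmPair.Pi)
  (hΔ : ∀ f : S.PiX ≃ₜ* S.PiX, S.DeltaX.map f.toMulEquiv.toMonoidHom = S.DeltaX)
  (hq : Nonempty (TopGroup.quot S.PiX S.DeltaX ≃ₜ* S.Gk))

namespace AbsTopMonoids

open Genuine

/-- **`O^gp(G) = (𝒪_k̄^⊳)^gp` IS `k̄^×` at the genuine producer**: there is a multiplicative isomorphism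
`Φ : O^gp(G) ⥲ k̄^×` sending the class of `m ∈ 𝒪_k̄^⊳` to `m` (every nonzero `x ∈ k̄` has `x ∈ 𝒪_k̄^⊳` or `x⁻¹ ∈ 𝒪_k̄^⊳`).
[claim: Mochizuki2012, status: disputed] (IUTchII §1 Ex 1.8 (vii), kurims p.40) -/
theorem genuineOfModel_exists_ogpEquiv (G : IsoClass S.Gk) :
    ∃ Φ : (genuineOfModel S C ε hΔ hq).Ogp G ≃* (C.K)ˣ,
      ∀ m : (genuineOfModel S C ε hΔ hq).Otri G, Φ (of m) = ModelMLFGaloisData.toUnit m := by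
  let f : (⊤ : Submonoid (nonzeroIntegers C.k C.K)).LocalizationMap (C.K)ˣ :=
    { toFun := fun m => ModelMLFGaloisData.toUnit m
      map_mul' := fun _ _ => Units.ext rfl
      isLocalizationMap :=
        { map_units := fun y => Group.isUnit _
          surj := fun z => by
            rcases C.mem_nonzeroIntegers_or_inv_mem z.ne_zero with hz | hz
            · exact ⟨(⟨(z : C.K), hz⟩, 1), Units.ext (by simp)⟩
            · refine ⟨(1, ⟨⟨((z : C.K))⁻¹, hz⟩, trivial⟩), Units.ext ?_⟩
              simp
          exists_of_eq := fun {x y} h => ⟨1, by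
            have h' : (x : C.K) = (y : C.K) := congrArg (fun u : (C.K)ˣ => (u : C.K)) h
            rw [Subtype.ext h']⟩ } }
  exact ⟨Localization.mulEquivOfQuotient f, fun m => Localization.mulEquivOfQuotient_monoidOf (f := f) m⟩

/-- The identification `Φ : O^gp(G) ⥲ k̄^×` with `Φ([m]) = m` is UNIQUE (two homomorphisms out of a groupification
agreeing on the monoid coincide). [claim: Mochizuki2012, status: disputed] (IUTchII §1 Ex 1.8 (vii), kurims p.40) -/
theorem genuineOfModel_ogpEquiv_unique (G : IsoClass S.Gk) {Φ Φ' : (genuineOfModel S C ε hΔ hq).Ogp G ≃* (C.K)ˣ}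
    (hΦ : ∀ m : (genuineOfModel S C ε hΔ hq).Otri G, Φ (of m) = ModelMLFGaloisData.toUnit m)
    (hΦ' : ∀ m : (genuineOfModel S C ε hΔ hq).Otri G, Φ' (of m) = ModelMLFGaloisData.toUnit m) : Φ = Φ' :=
  Groupification.mulEquiv_ext fun m => (hΦ m).trans (hΦ' m).symm

/-- **`Φ : O^gp(G) ⥲ k̄^×` is `G`-EQUIVARIANT** for the action induced on the groupification (`existsUnique_actOgp`) and
the Galois action of `G` on `k̄^×` through `theta : G ⥲ Gal(k̄/k)`. [claim: Mochizuki2012, status: disputed]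
(IUTchII §1 Ex 1.8 (vii), kurims p.40) -/
theorem genuineOfModel_ogpEquiv_equivariant (G : IsoClass S.Gk)
    {ρ : G.G →* MulAut ((genuineOfModel S C ε hΔ hq).Ogp G)}
    (hρ : ∀ (g : G.G) (m : (genuineOfModel S C ε hΔ hq).Otri G),
      ρ g (of m) = of ((genuineOfModel S C ε hΔ hq).actOtri G g m))
    {Φ : (genuineOfModel S C ε hΔ hq).Ogp G ≃* (C.K)ˣ}
    (hΦ : ∀ m : (genuineOfModel S C ε hΔ hq).Otri G, Φ (of m) = ModelMLFGaloisData.toUnit m)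
    (g : G.G) (x : (genuineOfModel S C ε hΔ hq).Ogp G) :
    (Φ (ρ g x) : C.K) = ((ModelMLFGaloisData.galois C.k C.K).aug (theta C ε G g)) (Φ x : C.K) := by
  have key : (Units.coeHom (C.K)).comp (Φ.toMonoidHom.comp (ρ g).toMonoidHom) =
      (((ModelMLFGaloisData.galois C.k C.K).aug (theta C ε G g) : C.K ≃ₐ[C.k] C.K) : C.K →* C.K).comp
        ((Units.coeHom (C.K)).comp Φ.toMonoidHom) := by
    refine Groupification.hom_ext fun m => ?_
    change (Φ (ρ g (of m)) : C.K) = ((ModelMLFGaloisData.galois C.k C.K).aug (theta C ε G g)) (Φ (of m) : C.K)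
    rw [hρ, hΦ, hΦ, ModelMLFGaloisData.coe_toUnit, ModelMLFGaloisData.coe_toUnit, genuineOfModel_actOtri_apply,
      ModelMLFGaloisData.nonzeroIntegers_coe_smul, AlgEquiv.smul_def]
  exact DFunLike.congr_fun key x

/-- **IUTchII:Rmk1.11.1(i)** (c), `(∗ĝp) := (∗gp)` reading, AT THE GENUINE PRODUCER: for the action `G ↷ O^gp(G)`
induced on the groupification, an automorphism of the pair `G ↷ O^gp(G)` lying over `1 ∈ Aut(G)` is the IDENTITY or
the INVERSION — `O^gp(G) ⥲ k̄^×` equivariantly, and a `Gal(k̄/k)`-equivariant automorphism of `k̄^×` is `x ↦ x^{±1}`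
([AbsTopIII] Prop. 3.3 (ii), `TLG`). [claim: Mochizuki2012, status: disputed] (IUTchII §1 Rmk 1.11.1 (i), kurims p.50) -/
theorem genuineOfModel_pairAut_ogp_over_one (G : IsoClass S.Gk)
    {ρ : G.G →* MulAut ((genuineOfModel S C ε hΔ hq).Ogp G)}
    (hρ : ∀ (g : G.G) (m : (genuineOfModel S C ε hΔ hq).Otri G),
      ρ g (of m) = of ((genuineOfModel S C ε hΔ hq).actOtri G g m))
    (p : PairAut G ((genuineOfModel S C ε hΔ hq).Ogp G) ρ) (hp : PairAut.forget p = 1) :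
    p.1.2 = MulEquiv.refl _ ∨ p.1.2 = MulEquiv.inv _ := by
  obtain ⟨Φ, hΦ⟩ := genuineOfModel_exists_ogpEquiv S C ε hΔ hq G
  have hψ : ∀ (g : G.G) (x : (genuineOfModel S C ε hΔ hq).Ogp G), p.1.2 (ρ g x) = ρ g (p.1.2 x) :=
    PairAut.smul_comm_of_forget_eq_one p hp
  have hE := genuineOfModel_ogpEquiv_equivariant S C ε hΔ hq G hρ hΦ
  -- `Φ.symm` is equivariant the other way round
  have hE' : ∀ (g : G.G) (u v : (C.K)ˣ),
      (v : C.K) = ((ModelMLFGaloisData.galois C.k C.K).aug (theta C ε G g)) (u : C.K) →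
        Φ.symm v = ρ g (Φ.symm u) := by
    intro g u v huv
    apply Φ.injective
    refine Units.ext ?_
    rw [MulEquiv.apply_symm_apply, hE, MulEquiv.apply_symm_apply]
    exact huv
  -- the conjugate `γ := Φ ∘ ψ ∘ Φ⁻¹` of `ψ := p.1.2` is a Galois-equivariant automorphism of `k̄^×`
  have hγ : ∀ (σ : C.K ≃ₐ[C.k] C.K) (u v : (C.K)ˣ), (v : C.K) = σ (u : C.K) →
      ((Φ.symm.trans (p.1.2.trans Φ)) v : C.K) = σ ((Φ.symm.trans (p.1.2.trans Φ)) u : C.K) := by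
    intro σ u v huv
    obtain ⟨g, hg⟩ : ∃ g : G.G, (ModelMLFGaloisData.galois C.k C.K).aug (theta C ε G g) = σ :=
      ⟨(theta C ε G).symm σ, by
        rw [ModelMLFGaloisData.galois_aug_apply]
        exact (theta C ε G).apply_symm_apply σ⟩
    subst hg
    rw [MulEquiv.trans_apply, MulEquiv.trans_apply, MulEquiv.trans_apply, MulEquiv.trans_apply,
      hE' g u v huv, hψ, hE]
  rcases units_equivariant_eq_id_or_inv C (Φ.symm.trans (p.1.2.trans Φ)) hγ with h | h
  · left
    refine MulEquiv.ext fun z => ?_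
    have h1 := h (Φ z)
    rw [MulEquiv.trans_apply, MulEquiv.trans_apply, MulEquiv.symm_apply_apply] at h1
    exact Φ.injective h1
  · right
    refine MulEquiv.ext fun z => ?_
    have h1 := h (Φ z)
    rw [MulEquiv.trans_apply, MulEquiv.trans_apply, MulEquiv.symm_apply_apply, ← map_inv] at h1
    rw [MulEquiv.inv_apply]
    exact Φ.injective h1

/-- At the genuine producer the identity and the inversion of `O^gp(G) ≅ k̄^×` are DIFFERENT (`2 ≠ 2⁻¹` in `k̄`, as
`2² = 4 ≠ 1` in characteristic `0`). [claim: Mochizuki2012, status: disputed] (IUTchII §1 Rmk 1.11.1 (i), kurims p.50) -/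
theorem genuineOfModel_ogp_inv_ne_refl (G : IsoClass S.Gk) :
    MulEquiv.inv ((genuineOfModel S C ε hΔ hq).Ogp G) ≠ MulEquiv.refl _ := by
  obtain ⟨Φ, -⟩ := genuineOfModel_exists_ogpEquiv S C ε hΔ hq G
  haveI : CharZero C.K := C.charZero_K
  intro h
  have h2 : (2 : C.K) ≠ 0 := two_ne_zero
  have h1 : (Φ ((MulEquiv.inv ((genuineOfModel S C ε hΔ hq).Ogp G)) (Φ.symm (Units.mk0 (2 : C.K) h2))) : C.K) =
      (Φ ((MulEquiv.refl ((genuineOfModel S C ε hΔ hq).Ogp G)) (Φ.symm (Units.mk0 (2 : C.K) h2))) : C.K) := by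
    rw [h]
  rw [MulEquiv.inv_apply, map_inv, MulEquiv.apply_symm_apply, MulEquiv.refl_apply, MulEquiv.apply_symm_apply,
    Units.val_inv_eq_inv_val, Units.val_mk0] at h1
  have h4 : (2 : C.K) * 2 = 1 := by
    calc (2 : C.K) * 2 = (2 : C.K)⁻¹ * 2 := by rw [h1]
      _ = 1 := inv_mul_cancel₀ h2
  norm_num at h4

/-- **The kernel of `Aut(G ↷ O^gp(G)) → Aut(G)` at the genuine producer has EXACTLY TWO elements**: a pair automorphism
lies over `1 ∈ Aut(G)` iff it is `1` or `(1, x ↦ x⁻¹)`. In the `(∗ĝp) := (∗gp)` reading this is what (c)'s "kernel …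
determined by the natural action of `Ẑ^×`" becomes: `{±1}`, not `Ẑ^×`. [claim: Mochizuki2012, status: disputed]
(IUTchII §1 Rmk 1.11.1 (i), kurims p.50) -/
theorem genuineOfModel_forget_ogp_eq_one_iff (G : IsoClass S.Gk)
    {ρ : G.G →* MulAut ((genuineOfModel S C ε hΔ hq).Ogp G)}
    (hρ : ∀ (g : G.G) (m : (genuineOfModel S C ε hΔ hq).Otri G),
      ρ g (of m) = of ((genuineOfModel S C ε hΔ hq).actOtri G g m))
    (p : PairAut G ((genuineOfModel S C ε hΔ hq).Ogp G) ρ) :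
    PairAut.forget p = 1 ↔
      p = 1 ∨ p = ⟨((1 : Aut G), MulEquiv.inv _), PairAut.inv_mem_over_one ρ⟩ := by
  constructor
  · intro hp
    have h1 : p.1.1 = 1 := hp
    rcases genuineOfModel_pairAut_ogp_over_one S C ε hΔ hq G hρ p hp with h | h
    · exact Or.inl (Subtype.ext (Prod.ext h1 h))
    · exact Or.inr (Subtype.ext (Prod.ext h1 h))
  · rintro (rfl | rfl) <;> rfl

/-- **Consequence for the `Ẑ^×`-datum of `Rmk1111_c` in the `(∗gp)` reading**: at the genuine producer, any
`z : Ẑ^× → Aut(O^gp(G))` all of whose values are `G`-equivariant (the third clause of `Rmk1111_c`) takes ONLY the values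
`1` and `x ↦ x⁻¹` — the `Γ = Ẑ^×`-indeterminacy cannot be carried by `O^gp(G)`; it needs the genuine profinite completions
`O^ĝp(G)` (L6 MERGE-MAP B9). [claim: Mochizuki2012, status: disputed] (IUTchII §1 Rmk 1.11.1 (i), kurims p.50) -/
theorem genuineOfModel_zhat_through_ogp (G : IsoClass S.Gk)
    {ρ : G.G →* MulAut ((genuineOfModel S C ε hΔ hq).Ogp G)}
    (hρ : ∀ (g : G.G) (m : (genuineOfModel S C ε hΔ hq).Otri G),
      ρ g (of m) = of ((genuineOfModel S C ε hΔ hq).actOtri G g m))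
    (z : ZHatUnits →* MulAut ((genuineOfModel S C ε hΔ hq).Ogp G))
    (hz : ∀ u : ZHatUnits, ((1 : Aut G), z u) ∈ PairAut G ((genuineOfModel S C ε hΔ hq).Ogp G) ρ) (u : ZHatUnits) :
    z u = MulEquiv.refl _ ∨ z u = MulEquiv.inv _ :=
  genuineOfModel_pairAut_ogp_over_one S C ε hΔ hq G hρ ⟨((1 : Aut G), z u), hz u⟩ rfl

end AbsTopMonoids

end Genuine

end Literature.IUT.HodgeArakelov
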